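import Summits.HodgeConjecture.HodgeConjecture.Theorems.H413E2SWSplitPlaceLetters   -- ★ p810933 (A-p01 (g13)): the letters over ★ `exists_splitPlaceFrame`
import HarnessLib

/-!
# H413 · E-2 · SW2 (iii) — I-CLOSE: the split-place LETTERS for a GIVEN frame `β` (β-parametric form of ★ `exists_splitPlaceLetters`)

Cell `hodgecm-mathlib`, crux H413 (`stmt-HodgeConjecture-24833`), child line `Cruxes/H413/Lines/F0_E2SiegelWeilWeilRange.lean`, stub
`stub_SW2iii_siegelWeil`, identity half, I-CLOSE (S-1)∕TRIPLES integration (F0P4-plan (g4) 2026-08-31 05:19:54Z (1): «the opaque `βv`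
cannot feed the riders which need the FORMULA frame»).  PROOF lane, `--supports stmt-HodgeConjecture-24833 --as helper`.  KERNEL
MATHEMATICS ONLY (theorems; no definition, no named fact, no `sorry`).  HC_CM is proved only modulo the 7 printed citations until rung 0
closes; nothing here is about Hodge classes.

★ `E2SWSplitPlaceLetters.exists_splitPlaceLetters` (A-p01 (g13)) produces the letters `eH, T, hfib, hT, hTh, hTS, hTe` of the generic
split-place producers over a frame `β` that it obtains INTERNALLY from ★ `exists_splitPlaceFrame`, so its `β` is opaque to the caller.
Every rider of the (S-1) glue (★ `twistLM_torus_apply`, ★ `splitEquiv_torusTwist`, (S-3E)) is stated on a `β` with a property — the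
pairing identity `hQ`, or the explicit formula of ★ `exists_splitPlaceFrame₃` — so the integrator must hold ONE `β` and read everything
on it.  This file is the same construction with `β` a PARAMETER: `exists_splitPlaceLetters_of_frame (β) (hQ) (hreal)` — inputs = the
clauses (E1) pairing identity and (E3) `v`-supported realisation of `(P, P⁻ᵀ)` of ★ `exists_splitPlaceFrame` ∕ `₂` ∕ `₃`, VERBATIM;
outputs = the letter clauses of ★ `exists_splitPlaceLetters`, VERBATIM (`eH := (β × id) ∘ placeSplitting⁻¹`, `T g := A_{sel g}`).

References: A. Weil, *Sur la formule de Siegel dans la théorie des groupes classiques*, Acta Math. 113 (1965), Chap. V n° 50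
pp. 73–74 [Weil1965].
-/

set_option autoImplicit false
-- the cell's `Summit.HodgeConjecture.HodgeConjecture.…` namespace repeats the summit name by design (D-0017 layout)
set_option linter.dupNamespace false

noncomputable section

open MeasureTheory NumberField Filter Topology Set IsDedekindDomain
open scoped NNReal Matrix ENNReal
open Literature.NumberTheory.Automorphic Literature.NumberTheory.Weil1964 Literature.NumberTheory.Weil1965
open Literature.NumberTheory.Weil1965.UnitaryDoubling
open Literature.NumberTheory.GelbartRogawski1991 Literature.NumberTheory.GelbartRogawski1991.UnitaryDualPair
open Literature.RepresentationTheory.HeisenbergGroup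
open Literature.NumberTheory.Automorphic.AdelicVector (evalAt trivialAt placeSplitting)
open Summit.HodgeConjecture.HodgeConjecture.Cruxes.H413.E2SWSplitPlaceFrame

namespace Summit.HodgeConjecture.HodgeConjecture.Cruxes.H413.E2SWSplitPlaceLettersOfFrame

/-- a linear equivalence from `K^m` onto `K^p × K^q` has a continuous inverse (all linear maps out of `K^p`, `K^q` are continuous).
[folklore] -/
private theorem continuous_linearEquiv_symm_prod {K : Type} [Field K] [TopologicalSpace K] [IsTopologicalRing K] {m p q : ℕ}
    (β : (Fin m → K) ≃ₗ[K] ((Fin p → K) × (Fin q → K))) : Continuous β.symm := by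
  haveI : ContinuousSMul K K := ⟨continuous_mul⟩
  have h1 : Continuous fun a : Fin p → K => β.symm.toLinearMap (LinearMap.inl K _ _ a) :=
    (β.symm.toLinearMap.comp (LinearMap.inl K _ _)).continuous_on_pi
  have h2 : Continuous fun b : Fin q → K => β.symm.toLinearMap (LinearMap.inr K _ _ b) :=
    (β.symm.toLinearMap.comp (LinearMap.inr K _ _)).continuous_on_pi
  have heq : (fun z : (Fin p → K) × (Fin q → K) => β.symm z) =
      fun z => β.symm.toLinearMap (LinearMap.inl K _ _ z.1) + β.symm.toLinearMap (LinearMap.inr K _ _ z.2) := by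
    funext z
    rw [← map_add, LinearMap.inl_apply, LinearMap.inr_apply, Prod.mk_add_mk, add_zero, zero_add]
    rfl
  have hc : Continuous fun z : (Fin p → K) × (Fin q → K) => β.symm z := by
    rw [heq]
    exact (h1.comp continuous_fst).add (h2.comp continuous_snd)
  exact hc

/-- the split-place LETTERS `eH, T, hfib, hT, hTh, hTS, hTe` built from a GIVEN frame `β` of ★ `exists_splitPlaceFrame` (its pairing
identity `hQ` and its realisation clause): the construction of ★ `E2SWSplitPlaceLetters.exists_splitPlaceLetters`, verbatim, made
parametric in `β` so that the same `β` can be fed to the (S-3E) binder.  (Adapted from ★ `E2SWSplitPlaceLetters`, A-p01 (g13); the private `letters_of_frame` of ★ p811637 made public.)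
[cite: Weil1965, Chap. V n° 50, pp. 73–74] -/
theorem exists_splitPlaceLetters_of_frame
    (F E : Type) [Field F] [NumberField F] [Field E] [NumberField E] [Algebra F E] [Algebra.IsQuadraticExtension F E]
    (c : E ≃ₐ[F] E) {δ : E} (hcδ : c δ = -δ) (hδ : δ ≠ 0) {d : F} (hd : δ * δ = algebraMap F E d)
    (N : ℕ) {n : ℕ} (e : Fin N × Fin 1 ≃ Fin n)
    (TV : Matrix (Fin N) (Fin N) F) (hV : TV.IsSymm) (hVd : IsUnit TV.det)
    (TW : Matrix (Fin 1) (Fin 1) F) (hW : TW.IsSymm) (hWd : IsUnit TW.det)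
    (v : HeightOneSpectrum (𝓞 F))
    (β : (Fin (n + n) → v.adicCompletion F) ≃ₗ[v.adicCompletion F] ((Fin n → v.adicCompletion F) × (Fin n → v.adicCompletion F)))
    (hQ : ∀ x : Fin (n + n) → AdeleRing (𝓞 F) F,
      AdelicGroupData.adeleEval F v (hNorm F E c hcδ hδ N e TV hVd TW hWd x) =
        (β (evalAt F (Fin (n + n)) v x)).1 ⬝ᵥ (β (evalAt F (Fin (n + n)) v x)).2)
    (hreal : ∀ P : GL (Fin n) (v.adicCompletion F), ∃ hU : UnitaryGroup.adelic F E c N (TV.map (algebraMap F E)),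
        (∀ y ∈ trivialAt F (Fin (n + n)) v, vDiagAct F E c hcδ hδ hd N e TV hV hVd TW hW hWd hU y = y) ∧
        (∀ x : Fin (n + n) → AdeleRing (𝓞 F) F,
          β (evalAt F (Fin (n + n)) v (vDiagAct F E c hcδ hδ hd N e TV hV hVd TW hW hWd hU x)) =
            ((P : Matrix (Fin n) (Fin n) (v.adicCompletion F)) *ᵥ (β (evalAt F (Fin (n + n)) v x)).1,
              ((P⁻¹ : GL (Fin n) (v.adicCompletion F)) : Matrix (Fin n) (Fin n) (v.adicCompletion F))ᵀ *ᵥ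
                (β (evalAt F (Fin (n + n)) v x)).2)) ∧
        (∀ x : Fin (n + n) → AdeleRing (𝓞 F) F,
          ((placeSplitting F (Fin (n + n)) v).symm (vDiagAct F E c hcδ hδ hd N e TV hV hVd TW hW hWd hU x)).2 =
            ((placeSplitting F (Fin (n + n)) v).symm x).2)) :
    ∃ (eH : (Fin (n + n) → AdeleRing (𝓞 F) F) ≃ₜ
        ((Fin n → v.adicCompletion F) × (Fin n → v.adicCompletion F)) × trivialAt F (Fin (n + n)) v)
      (T : GL (Fin n) (v.adicCompletion F) → ((Fin (n + n) → AdeleRing (𝓞 F) F) ≃ₜ (Fin (n + n) → AdeleRing (𝓞 F) F))),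
      (∀ x, eH x = (β (evalAt F (Fin (n + n)) v x), ((placeSplitting F (Fin (n + n)) v).symm x).2)) ∧
      (∀ (x : Fin (n + n) → AdeleRing (𝓞 F) F) (b : F),
        hNorm F E c hcδ hδ N e TV hVd TW hWd x = algebraMap F (AdeleRing (𝓞 F) F) b →
          (eH x).1.1 ⬝ᵥ (eH x).1.2 = (b : v.adicCompletion F)) ∧
      (∀ g, ∃ hU : UnitaryGroup.adelic F E c N (TV.map (algebraMap F E)),
        ⇑(T g) = ⇑(vDiagAct F E c hcδ hδ hd N e TV hV hVd TW hW hWd hU)) ∧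
      (∀ g x, hNorm F E c hcδ hδ N e TV hVd TW hWd (T g x) = hNorm F E c hcδ hδ N e TV hVd TW hWd x) ∧
      (∀ g, ∀ Φ ∈ piSchwartzBruhat F (Fin (n + n)), Φ ∘ ⇑(T g) ∈ piSchwartzBruhat F (Fin (n + n))) ∧
      (∀ g x, eH (T g x) =
        ((((g : Matrix (Fin n) (Fin n) (v.adicCompletion F)) *ᵥ (eH x).1.1,
            ((g⁻¹ : GL (Fin n) (v.adicCompletion F)) : Matrix (Fin n) (Fin n) (v.adicCompletion F))ᵀ *ᵥ (eH x).1.2) :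
              (Fin n → v.adicCompletion F) × (Fin n → v.adicCompletion F)), (eH x).2)) := by
  choose sel hfix hii hsnd using hreal
  haveI : ContinuousSMul (v.adicCompletion F) (v.adicCompletion F) := ⟨continuous_mul⟩
  haveI : ContinuousSMul (AdeleRing (𝓞 F) F) (AdeleRing (𝓞 F) F) := ⟨continuous_mul⟩
  -- `β` as a homeomorphism, `e := (β × id) ∘ placeSplitting⁻¹`
  let βH : (Fin (n + n) → v.adicCompletion F) ≃ₜ ((Fin n → v.adicCompletion F) × (Fin n → v.adicCompletion F)) :=
    { toEquiv := β.toEquiv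
      continuous_toFun := β.toLinearMap.continuous_on_pi
      continuous_invFun := continuous_linearEquiv_symm_prod β }
  let eH : (Fin (n + n) → AdeleRing (𝓞 F) F) ≃ₜ
      ((Fin n → v.adicCompletion F) × (Fin n → v.adicCompletion F)) × trivialAt F (Fin (n + n)) v :=
    (placeSplitting F (Fin (n + n)) v).symm.toHomeomorph.trans (βH.prodCongr (Homeomorph.refl _))
  -- `T g := A_{sel g}` as a homeomorphism
  let T : GL (Fin n) (v.adicCompletion F) → ((Fin (n + n) → AdeleRing (𝓞 F) F) ≃ₜ (Fin (n + n) → AdeleRing (𝓞 F) F)) :=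
    fun g =>
      { toEquiv := (vDiagAct F E c hcδ hδ hd N e TV hV hVd TW hW hWd (sel g)).toEquiv
        continuous_toFun := (vDiagAct F E c hcδ hδ hd N e TV hV hVd TW hW hWd (sel g)).toLinearMap.continuous_on_pi
        continuous_invFun := (vDiagAct F E c hcδ hδ hd N e TV hV hVd TW hW hWd (sel g)).symm.toLinearMap.continuous_on_pi }
  have heH : ∀ x, eH x = (β (evalAt F (Fin (n + n)) v x), ((placeSplitting F (Fin (n + n)) v).symm x).2) := fun x => rfl
  have hT : ∀ g, ⇑(T g) = ⇑(vDiagAct F E c hcδ hδ hd N e TV hV hVd TW hW hWd (sel g)) := fun g => rfl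
  refine ⟨eH, T, heH, fun x b hxb => ?_, fun g => ⟨sel g, hT g⟩, fun g x => ?_, fun g Φ hΦ => ?_, fun g x => ?_⟩
  · -- `hfib` core (pairing letter)
    rw [heH]
    change (β (evalAt F (Fin (n + n)) v x)).1 ⬝ᵥ (β (evalAt F (Fin (n + n)) v x)).2 = _
    rw [← hQ x, hxb]
    rfl
  · -- `hTh`
    exact hNorm_vDiagAct F E c hcδ hδ hd N e TV hV hVd TW hW hWd (sel g) x
  · -- `hTS`
    have hc : Φ ∘ ⇑(T g) = twist F (actTwistGL F (vDiagAct F E c hcδ hδ hd N e TV hV hVd TW hW hWd) (sel g)) Φ :=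
      funext fun x => (twist_actTwistGL F (vDiagAct F E c hcδ hδ hd N e TV hV hVd TW hW hWd) (sel g) Φ x).symm
    rw [hc]
    exact twist_mem hΦ _
  · -- `hTe`
    rw [heH, heH]
    change (β (evalAt F (Fin (n + n)) v (vDiagAct F E c hcδ hδ hd N e TV hV hVd TW hW hWd (sel g) x)),
        ((placeSplitting F (Fin (n + n)) v).symm (vDiagAct F E c hcδ hδ hd N e TV hV hVd TW hW hWd (sel g) x)).2) = _
    rw [hii g x, hsnd g x]

end Summit.HodgeConjecture.HodgeConjecture.Cruxes.H413.E2SWSplitPlaceLettersOfFrame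

end
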